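import Summits.HodgeConjecture.HodgeConjecture.Theorems.R90S9SgTailOfAeOfXiLocalFamily     -- ★ p862121 (this seat): `sgTail_of_ae_of_xiLocalFamily` (+ the (AE) ∕ (S-G) ∕ `hFs` currency of ★ `definiteXiMembership_of_ch14`, `CMCharIdentityPackageTestSigned`)
import Summits.HodgeConjecture.HodgeConjecture.Theorems.F0P3XiPacketFamilyOfRecordSCD      -- ★ `xiPacketFamilyOfRecordSCD` (the A-packet family of record), `_of_nonsplit`, `isXiLocalFamily_xiPacketFamilyOfRecordSCD`
import Summits.HodgeConjecture.HodgeConjecture.Theorems.F0P3cDbTKeysLabelRigidity          -- ★ `comap_keysLabelCM_eq` (the transported Keys label is intrinsic: across Haar measures and frames, hypothesis-free)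
import Literature.NumberTheory.Rogawski1990.CharIdentityOnTestFunctionsFormSign            -- ★ `clauseSign_eq_intCast_formSignAt` (the clause sign of every frame is `ε_v(H)`)
import HarnessLib

/-!
# R90-TF · S9 «InnerForm-13.3.6 (c)» — (α) PART 1: THE SIGNED READ-BACK OF THE A-PACKET FAMILY OF RECORD (`hread` ∕ `hback` of the (AE-ⅱ) cut AT THE DATUM)
# (Rogawski 1990, §13.1 Prop. 13.1.3 (d), Prop. 13.1.4 p. 199; §12.2 (2) pp. 173–174; Thm. 14.6.4 p. 244)

Cell `hodgecm-mathlib`, crux H413 (`stmt-HodgeConjecture-24833`, lane `--supports … --as helper`), route of record `HCCMUnconditional` (no route verbs; count-neutral).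
Programme R90-TF (brief `director/R90-BRIEF.v2.md` 1f40d54518340a35), section S9 = InnerForm-13.3.6 (c) (base `R90-IF`); seat R90-IF-p06 (g0); deal (α)
`definiteAeRigidity_ofDatum` (R90-IF-plan (g0) DEAL MAP 16:51:37Z (4), S9-R-CMP v2 22:00:32Z (e): «(α) proceeds on (D)∕(L) ED. 2′ + the instance»).  THEOREMS ONLY
(no `def`, no instance, no notation, no named-fact hypothesis, no `sorry`).
HONEST LABEL: HC_CM is proved only modulo the 7 printed citations (2 remaining named inputs: hLiu418 = stmt-HodgeConjecture-24832, h413 = stmt-HodgeConjecture-24833) —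
until rung 0 closes.  Datum book-keeping over ★ rigidity lemmas; no leaf moves; REL ≠ ★ ≠ BUILT.

WHAT.  The (AE-ⅱ) cut ★ `definiteAeRigidity_of_parts` (p862161) leaves the datum-level pin
`hread : Γ.evp (Γ.PiXi′ ξ′ …) Pξ → Γ.mem′ π′ (Γ.PiXi′ ξ′ …) → ∃ ξ₁ F, ξ₁.IsXiLocalFamily … F ∧ LocalConstituentsIn P F ∧ ‹the second members of F are the SIGNED witnesses
((hQS ξ₁).1 v …).πs, for EVERY frame, Haar measure and Keys labelling›`.  At R90-IF-p01's datum (★ `InnerFormSec146` ED. 2′: `mem′ := memPrime Ξ`, `PiXi′ := piXiPrime Ξ`,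
★ `memPrime_piXiPrime_iff : memPrime (classOf P) (piXiPrime Ξ ξ₁) ↔ LocalConstituentsIn P (Ξ ξ₁)`) with `Ξ` THE A-PACKET FAMILY OF RECORD ★ `xiPacketFamilyOfRecordSCD …
μZ keys hSC` (at a non-split `v`: `⟨πⁿ ∘ e₀, some πˢ⟩` at the record frame `e₀`, the record's Keys labels and the supercuspidal partner `πˢ` read off the datum `hSC`),
this pin READS `LocalConstituentsIn P (Ξ ξ₁) → …`, and THIS FILE PROVES IT (`sgReadBack_of_recordSCD`), under the single link hypothesis
`hSCQ : (hSC ξ v hns T a ha h π2 πn hK hn).1 = ((hQS ξ).1 v hns T a ha h (μZ v) π2 πn hK hn).πs` («the partner of record IS the `hQS`-witness at the record's own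
binders» — `rfl` when the assembler builds `hSC` from the signed Q-package `hQS`, as it must).  The content is the INTRINSIC NATURE OF THE SIGNED WITNESS
(`packagePis_eq_of_labels`): `((hQS ξ).1 v hns T a ha h μZ π2 πn hK hn).πs` does not depend on the frame `(T, a)`, on the Haar measure `μZ` labelling the Keys pair, nor on
the labelled pair — because the PROPOSITION it is chosen from, ★ `CMNonsplitCharIdentityAtTestSigned … ε (πⁿ ∘ e)`, does not: its sign is `ε_v(H)` for every frame (★
`clauseSign_eq_intCast_formSignAt`) and its class `πⁿ ∘ e` is intrinsic (★ `comap_keysLabelCM_eq`: Keys' case (2) across Haar measures + K5 congruence independence,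
hypothesis-free) — then proof irrelevance (`signedPis_congr`).  No (H₇) matching hypothesis is used.
* §1 `signedPis_congr` — `h.πs = h′.πs` for signed letters at equal sign and class.
* §2 `packagePis_eq_of_labels` — the `hQS`-witness is the same at any two binder tuples `(T, a, h, μZ, π², πⁿ)`.
* §3 `signedMembers_recordSCD` — the `hFs` clause of ★ p862161 ∕ ★ p862121 for `F := Ξ ξ₁`; `sgReadBack_of_recordSCD` — ★ p862161's `hread` CONCLUSION, token for token,
  from `LocalConstituentsIn P (Ξ ξ₁)`; `sgTail_of_ae_of_recordSCD` — the engine's `hback` AT THE RECORD: (AE) + `LocalConstituentsIn P (Ξ ξ₁)` ⟹ the (S-G) tail (★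
  `sgTail_of_ae_of_xiLocalFamily`).

[cite: Rogawski1990, §13.1 Prop. 13.1.3 (d), Prop. 13.1.4 p. 199; §12.2 (2) pp. 173–174; §14.6 Thm. 14.6.4 p. 244; §14.2 p. 234] [cite: Keys1984, §7 Thm. p. 126]
[cite: LanglandsShelstad1987, §1]
-/

set_option autoImplicit false
-- the mandated namespace repeats `HodgeConjecture.HodgeConjecture`, as in every `Theorems/*.lean` of this sub-problem
set_option linter.dupNamespace false

noncomputable section

open NumberField IsDedekindDomain MeasureTheory
open scoped Matrix ComplexOrder

open Literature.NumberTheory Literature.NumberTheory.Automorphic Literature.NumberTheory.Automorphic.UnitaryGroup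
open Literature.NumberTheory.Automorphic.IdeleClassGroup
open Literature.NumberTheory.GaloisRepresentations
open Literature.NumberTheory.Rogawski1990

namespace Summit.HodgeConjecture.HodgeConjecture.R90.S9

open Summit.HodgeConjecture.HodgeConjecture.Cruxes.H413
open Summit.HodgeConjecture.HodgeConjecture.Cruxes.H413.F0P3XiPacketFamilyOfRecordSCD (xiPacketFamilyOfRecordSCD xiPacketFamilyOfRecordSCD_of_nonsplit
  isXiLocalFamily_xiPacketFamilyOfRecordSCD)
open Summit.HodgeConjecture.HodgeConjecture.Cruxes.H413.F0P3cDbTKeysLabelRigidity (comap_keysLabelCM_eq)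

/-! ## §1 Proof irrelevance of the signed witness -/

section Congr

variable {L : Type} [Field L] [NumberField L] [IsCMField L] {v : HeightOneSpectrum (𝓞 ↥(maximalRealSubfield L))} {H' : Matrix (Fin 3) (Fin 3) L}
    [MeasurableSpace ((cmDatum L 3 H').Local v)]
    [MeasurableSpace ((cmDatum L 2 (Matrix.of fun i j : Fin 2 => if i.val + j.val + 1 = 2 then (1 : L) else 0)).Local v ×
      (cmDatum L 1 (Matrix.of fun i j : Fin 1 => if i.val + j.val + 1 = 1 then (1 : L) else 0)).Local v)]
    [∀ a : ((cmDatum L 2 (Matrix.of fun i j : Fin 2 => if i.val + j.val + 1 = 2 then (1 : L) else 0)).Local v ×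
        (cmDatum L 1 (Matrix.of fun i j : Fin 1 => if i.val + j.val + 1 = 1 then (1 : L) else 0)).Local v),
      MeasurableSpace (((cmDatum L 2 (Matrix.of fun i j : Fin 2 => if i.val + j.val + 1 = 2 then (1 : L) else 0)).Local v ×
        (cmDatum L 1 (Matrix.of fun i j : Fin 1 => if i.val + j.val + 1 = 1 then (1 : L) else 0)).Local v) ⧸
        Subgroup.centralizer ({a} : Set ((cmDatum L 2 (Matrix.of fun i j : Fin 2 => if i.val + j.val + 1 = 2 then (1 : L) else 0)).Local v ×
        (cmDatum L 1 (Matrix.of fun i j : Fin 1 => if i.val + j.val + 1 = 1 then (1 : L) else 0)).Local v)))]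
    [∀ γ : (cmDatum L 3 H').Local v, MeasurableSpace ((cmDatum L 3 H').Local v ⧸ Subgroup.centralizer ({γ} : Set ((cmDatum L 3 H').Local v)))]
    {T : LocalTransferFactor L H' v}
    {mH : OrbitalMeasureFamily ((cmDatum L 2 (Matrix.of fun i j : Fin 2 => if i.val + j.val + 1 = 2 then (1 : L) else 0)).Local v ×
        (cmDatum L 1 (Matrix.of fun i j : Fin 1 => if i.val + j.val + 1 = 1 then (1 : L) else 0)).Local v)}
    {mG : OrbitalMeasureFamily ((cmDatum L 3 H').Local v)} {μG : Measure ((cmDatum L 3 H').Local v)}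
    {μH : Measure ((cmDatum L 2 (Matrix.of fun i j : Fin 2 => if i.val + j.val + 1 = 2 then (1 : L) else 0)).Local v ×
        (cmDatum L 1 (Matrix.of fun i j : Fin 1 => if i.val + j.val + 1 = 1 then (1 : L) else 0)).Local v)}
    {ξv : (cmDatum L 2 (Matrix.of fun i j : Fin 2 => if i.val + j.val + 1 = 2 then (1 : L) else 0)).Local v ×
        (cmDatum L 1 (Matrix.of fun i j : Fin 1 => if i.val + j.val + 1 = 1 then (1 : L) else 0)).Local v →* ℂˣ}

/-- **Proof irrelevance of the signed witness `πˢ`**: signed letters [13.1.4] at EQUAL sign and EQUAL class `πⁿ` are the same proposition, so their chosen partners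
★ `CMNonsplitCharIdentityAtTestSigned.πs` coincide. [cite: Rogawski1990, §13.1 Prop. 13.1.3 (d), Prop. 13.1.4 p. 199] -/
theorem signedPis_congr {ε ε' : ℂ} {πn πn' : IrrClass ((cmDatum L 3 H').Local v)}
    (h : CMNonsplitCharIdentityAtTestSigned L v H' T mH mG μG μH ξv ε πn) (h' : CMNonsplitCharIdentityAtTestSigned L v H' T mH mG μG μH ξv ε' πn')
    (hε : ε = ε') (hπ : πn = πn') : h.πs = h'.πs := by
  subst hε hπ
  rfl

end Congr

/-! ## §2 The `hQS`-witness is intrinsic: independent of the frame, of the Haar measure and of the Keys labelling -/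

section Package

variable (L : Type) [Field L] [NumberField L] [IsCMField L] (H : Matrix (Fin 3) (Fin 3) L)
    (hH : (H.map (cmConjRingHom L))ᵀ = H) (hHd : IsUnit H.det)
    [∀ v : HeightOneSpectrum (𝓞 ↥(maximalRealSubfield L)), MeasurableSpace ((cmDatum L 3 H).Local v)]
    [∀ v : HeightOneSpectrum (𝓞 ↥(maximalRealSubfield L)),
      MeasurableSpace ((cmDatum L 2 (Matrix.of fun i j : Fin 2 => if i.val + j.val + 1 = 2 then (1 : L) else 0)).Local v ×
        (cmDatum L 1 (Matrix.of fun i j : Fin 1 => if i.val + j.val + 1 = 1 then (1 : L) else 0)).Local v)]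
    [∀ (v : HeightOneSpectrum (𝓞 ↥(maximalRealSubfield L)))
        (a : ((cmDatum L 2 (Matrix.of fun i j : Fin 2 => if i.val + j.val + 1 = 2 then (1 : L) else 0)).Local v ×
          (cmDatum L 1 (Matrix.of fun i j : Fin 1 => if i.val + j.val + 1 = 1 then (1 : L) else 0)).Local v)),
      MeasurableSpace (((cmDatum L 2 (Matrix.of fun i j : Fin 2 => if i.val + j.val + 1 = 2 then (1 : L) else 0)).Local v ×
          (cmDatum L 1 (Matrix.of fun i j : Fin 1 => if i.val + j.val + 1 = 1 then (1 : L) else 0)).Local v) ⧸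
        Subgroup.centralizer ({a} : Set ((cmDatum L 2 (Matrix.of fun i j : Fin 2 => if i.val + j.val + 1 = 2 then (1 : L) else 0)).Local v ×
          (cmDatum L 1 (Matrix.of fun i j : Fin 1 => if i.val + j.val + 1 = 1 then (1 : L) else 0)).Local v)))]
    [∀ (v : HeightOneSpectrum (𝓞 ↥(maximalRealSubfield L))) (γ : (cmDatum L 3 H).Local v),
      MeasurableSpace ((cmDatum L 3 H).Local v ⧸ Subgroup.centralizer ({γ} : Set ((cmDatum L 3 H).Local v)))]
    {Δ : ∀ v : HeightOneSpectrum (𝓞 ↥(maximalRealSubfield L)), LocalTransferFactor L H v}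
    {mH : ∀ v : HeightOneSpectrum (𝓞 ↥(maximalRealSubfield L)),
      OrbitalMeasureFamily ((cmDatum L 2 (Matrix.of fun i j : Fin 2 => if i.val + j.val + 1 = 2 then (1 : L) else 0)).Local v ×
        (cmDatum L 1 (Matrix.of fun i j : Fin 1 => if i.val + j.val + 1 = 1 then (1 : L) else 0)).Local v)}
    {mG : ∀ v : HeightOneSpectrum (𝓞 ↥(maximalRealSubfield L)), OrbitalMeasureFamily ((cmDatum L 3 H).Local v)}
    {νH : ∀ v : HeightOneSpectrum (𝓞 ↥(maximalRealSubfield L)),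
      Measure ((cmDatum L 2 (Matrix.of fun i j : Fin 2 => if i.val + j.val + 1 = 2 then (1 : L) else 0)).Local v ×
        (cmDatum L 1 (Matrix.of fun i j : Fin 1 => if i.val + j.val + 1 = 1 then (1 : L) else 0)).Local v)}
    {νG : ∀ v : HeightOneSpectrum (𝓞 ↥(maximalRealSubfield L)), Measure ((cmDatum L 3 H).Local v)}
    (μω : HeckeCharacter L) {hμu : μω.IsUnitary}
    (hQS : CMCharIdentityPackageTestSigned L H hH hHd νH νG μω hμu Δ mH mG) (ξ : OneDimAutRepH L)

open scoped Classical in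
set_option synthInstance.maxHeartbeats 400000 in
set_option maxHeartbeats 4000000 in
/-- **`packagePis_eq_of_labels` — THE SIGNED WITNESS `πˢ(ξ_v) ∘ e` READ OFF `hQS` IS INTRINSIC.**  At a non-split `v`, for ANY two binder tuples of the (S-G) clause — frames
`ᵗσT·H_v·T = a·Φ₃`, `ᵗσT′·H_v·T′ = a′·Φ₃`, Haar measures `μZ, μZ′` on `U(Φ₃)(L⁺_v)⧸Z`, Keys labellings `(π², πⁿ)`, `(π²′, πⁿ′)` with `πⁿ`, `πⁿ′` not square-integrable —
the partners read off the signed Q-package coincide: `((hQS ξ).1 v hns T a ha h μZ π2 πn hK hn).πs = ((hQS ξ).1 v hns T′ a′ ha′ h′ μZ′ π2′ πn′ hK′ hn′).πs`.  Proof: both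
signed letters have the sign `ε_v(H)` (★ `clauseSign_eq_intCast_formSignAt`) and the class `πⁿ ∘ e = πⁿ′ ∘ e′` (★ `comap_keysLabelCM_eq`, hypothesis-free Keys rigidity
across Haar measures + K5 congruence independence); §1.  [cite: Rogawski1990, §13.1 Prop. 13.1.3 (d), Prop. 13.1.4 p. 199; §12.2 (2) pp. 173–174; §14.2 p. 234]
[cite: Keys1984, §7 Thm. p. 126] -/
theorem packagePis_eq_of_labels
    (hμω : ∀ x : Literature.NumberTheory.GaloisRepresentations.ideleGroup ↥(maximalRealSubfield L),
      μω (AdeleRing.ideleBaseChange (↥(maximalRealSubfield L)) L x) = quadraticHeckeCharCM L x)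
    {v : HeightOneSpectrum (𝓞 ↥(maximalRealSubfield L))} (hns : ∀ w : PlacesOver L v, IsCMField.complexConj L • w.1 = w.1)
    (T T' : GL (Fin 3) (LocalRing L v)) (a a' : LocalRing L v) (ha : IsUnit a) (ha' : IsUnit a')
    (h : formCongr (conjLocal L (IsCMField.complexConj L) v) T (H.map (algebraMap L (LocalRing L v))) =
      a • (Matrix.of fun i j : Fin 3 => if i.val + j.val + 1 = 3 then (1 : L) else 0).map (algebraMap L (LocalRing L v)))
    (h' : formCongr (conjLocal L (IsCMField.complexConj L) v) T' (H.map (algebraMap L (LocalRing L v))) =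
      a' • (Matrix.of fun i j : Fin 3 => if i.val + j.val + 1 = 3 then (1 : L) else 0).map (algebraMap L (LocalRing L v)))
    [MeasurableSpace (Gqs L v ⧸ Subgroup.center (Gqs L v))] [BorelSpace (Gqs L v ⧸ Subgroup.center (Gqs L v))]
    (μZ μZ' : Measure (Gqs L v ⧸ Subgroup.center (Gqs L v))) [μZ.IsHaarMeasure] [μZ'.IsHaarMeasure]
    (π2 πn π2' πn' : IrrClass (Gqs L v))
    (hK : KeysCaseTwoLabels L v (μω.semilocalComponent L v) (torusLocalComponent L (IsCMField.complexConj L) v ξ.η)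
      (torusLocalComponent L (IsCMField.complexConj L) v ξ.ψ) π2 πn)
    (hK' : KeysCaseTwoLabels L v (μω.semilocalComponent L v) (torusLocalComponent L (IsCMField.complexConj L) v ξ.η)
      (torusLocalComponent L (IsCMField.complexConj L) v ξ.ψ) π2' πn')
    (hn : ¬ πn.IsSquareIntegrable μZ) (hn' : ¬ πn'.IsSquareIntegrable μZ') :
    ((hQS ξ).1 v hns T a ha h μZ π2 πn hK hn).πs = ((hQS ξ).1 v hns T' a' ha' h' μZ' π2' πn' hK' hn').πs :=
  signedPis_congr _ _ (by rw [clauseSign_eq_intCast_formSignAt L H hH v hns T a ha h, clauseSign_eq_intCast_formSignAt L H hH v hns T' a' ha' h'])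
    (comap_keysLabelCM_eq hH μω hμω ξ hns T T' ha ha' h h' μZ μZ' hK hK' hn hn')

end Package

/-! ## §3 The signed members of the A-packet family of record; the read-back pin of the (AE-ⅱ) cut at the record -/

section Record

variable (L : Type) [Field L] [NumberField L] [IsCMField L] (H : Matrix (Fin 3) (Fin 3) L)
    (hH : (H.map (cmConjRingHom L))ᵀ = H) (hHd : IsUnit H.det)
    [∀ v : HeightOneSpectrum (𝓞 ↥(maximalRealSubfield L)), MeasurableSpace ((cmDatum L 3 H).Local v)]
    [∀ v : HeightOneSpectrum (𝓞 ↥(maximalRealSubfield L)),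
      MeasurableSpace ((cmDatum L 2 (Matrix.of fun i j : Fin 2 => if i.val + j.val + 1 = 2 then (1 : L) else 0)).Local v ×
        (cmDatum L 1 (Matrix.of fun i j : Fin 1 => if i.val + j.val + 1 = 1 then (1 : L) else 0)).Local v)]
    [∀ (v : HeightOneSpectrum (𝓞 ↥(maximalRealSubfield L)))
        (a : ((cmDatum L 2 (Matrix.of fun i j : Fin 2 => if i.val + j.val + 1 = 2 then (1 : L) else 0)).Local v ×
          (cmDatum L 1 (Matrix.of fun i j : Fin 1 => if i.val + j.val + 1 = 1 then (1 : L) else 0)).Local v)),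
      MeasurableSpace (((cmDatum L 2 (Matrix.of fun i j : Fin 2 => if i.val + j.val + 1 = 2 then (1 : L) else 0)).Local v ×
          (cmDatum L 1 (Matrix.of fun i j : Fin 1 => if i.val + j.val + 1 = 1 then (1 : L) else 0)).Local v) ⧸
        Subgroup.centralizer ({a} : Set ((cmDatum L 2 (Matrix.of fun i j : Fin 2 => if i.val + j.val + 1 = 2 then (1 : L) else 0)).Local v ×
          (cmDatum L 1 (Matrix.of fun i j : Fin 1 => if i.val + j.val + 1 = 1 then (1 : L) else 0)).Local v)))]
    [∀ (v : HeightOneSpectrum (𝓞 ↥(maximalRealSubfield L))) (γ : (cmDatum L 3 H).Local v),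
      MeasurableSpace ((cmDatum L 3 H).Local v ⧸ Subgroup.centralizer ({γ} : Set ((cmDatum L 3 H).Local v)))]
    (Δ : ∀ v : HeightOneSpectrum (𝓞 ↥(maximalRealSubfield L)), LocalTransferFactor L H v)
    (mH : ∀ v : HeightOneSpectrum (𝓞 ↥(maximalRealSubfield L)),
      OrbitalMeasureFamily ((cmDatum L 2 (Matrix.of fun i j : Fin 2 => if i.val + j.val + 1 = 2 then (1 : L) else 0)).Local v ×
        (cmDatum L 1 (Matrix.of fun i j : Fin 1 => if i.val + j.val + 1 = 1 then (1 : L) else 0)).Local v))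
    (mG : ∀ v : HeightOneSpectrum (𝓞 ↥(maximalRealSubfield L)), OrbitalMeasureFamily ((cmDatum L 3 H).Local v))
    (νG : ∀ v : HeightOneSpectrum (𝓞 ↥(maximalRealSubfield L)), Measure ((cmDatum L 3 H).Local v))
    (νH : ∀ v : HeightOneSpectrum (𝓞 ↥(maximalRealSubfield L)),
      Measure ((cmDatum L 2 (Matrix.of fun i j : Fin 2 => if i.val + j.val + 1 = 2 then (1 : L) else 0)).Local v ×
        (cmDatum L 1 (Matrix.of fun i j : Fin 1 => if i.val + j.val + 1 = 1 then (1 : L) else 0)).Local v))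
    (μω : HeckeCharacter L) (hμu : μω.IsUnitary)
    (hQS : CMCharIdentityPackageTestSigned L H hH hHd νH νG μω hμu Δ mH mG)
    -- THE RECORD'S V6 DATA: Borel Haar measures on the `U(Φ₃)(L⁺_v)⧸Z`, Keys' labelled pairs with their `L²` data, the supercuspidal partner datum `hSC`
    [iZ : ∀ v : HeightOneSpectrum (𝓞 ↥(maximalRealSubfield L)), MeasurableSpace (Gqs L v ⧸ Subgroup.center (Gqs L v))]
    [iB : ∀ v : HeightOneSpectrum (𝓞 ↥(maximalRealSubfield L)), BorelSpace (Gqs L v ⧸ Subgroup.center (Gqs L v))]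
    (μZ : ∀ v : HeightOneSpectrum (𝓞 ↥(maximalRealSubfield L)), Measure (Gqs L v ⧸ Subgroup.center (Gqs L v)))
    [∀ v : HeightOneSpectrum (𝓞 ↥(maximalRealSubfield L)), (μZ v).IsHaarMeasure]
    (keys : ∀ (ξ : OneDimAutRepH L) (v : HeightOneSpectrum (𝓞 ↥(maximalRealSubfield L))),
      (∀ w : PlacesOver L v, IsCMField.complexConj L • w.1 = w.1) →
        {p : IrrClass (Gqs L v) × IrrClass (Gqs L v) //
          KeysCaseTwoLabels L v (μω.semilocalComponent L v) (torusLocalComponent L (IsCMField.complexConj L) v ξ.η)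
            (torusLocalComponent L (IsCMField.complexConj L) v ξ.ψ) p.1 p.2 ∧
          p.1.IsSquareIntegrable (μZ v) ∧ ¬ p.2.IsSquareIntegrable (μZ v)})
    (hSC : ∀ (ξ : OneDimAutRepH L) (v : HeightOneSpectrum (𝓞 ↥(maximalRealSubfield L)))
      (hns : ∀ w : PlacesOver L v, IsCMField.complexConj L • w.1 = w.1)
      (T : GL (Fin 3) (LocalRing L v)) (a : LocalRing L v) (ha : IsUnit a)
      (h : formCongr (conjLocal L (IsCMField.complexConj L) v) T (H.map (algebraMap L (LocalRing L v))) =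
        a • (Matrix.of fun i j : Fin 3 => if i.val + j.val + 1 = 3 then (1 : L) else 0).map (algebraMap L (LocalRing L v)))
      (π2 πn : IrrClass (Gqs L v)),
      KeysCaseTwoLabels L v (μω.semilocalComponent L v) (torusLocalComponent L (IsCMField.complexConj L) v ξ.η)
        (torusLocalComponent L (IsCMField.complexConj L) v ξ.ψ) π2 πn → ¬ πn.IsSquareIntegrable (μZ v) →
      {πs : IrrClass ((cmDatum L 3 H).Local v) // πs.IsSupercuspidal ∧ πs ≠ IrrClass.comap (cmDatumLocalCongr L v T ha h).symm πn})

open scoped Classical in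
set_option synthInstance.maxHeartbeats 400000 in
set_option maxHeartbeats 8000000 in
/-- **`signedMembers_recordSCD` — THE SECOND MEMBERS OF THE A-PACKET FAMILY OF RECORD ARE THE SIGNED WITNESSES** (the `hFs` clause of ★ `definiteAeRigidity_of_parts` ∕ ★
`sgTail_of_ae_of_xiLocalFamily` for `F := xiPacketFamilyOfRecordSCD … ξ₁`): at a non-split `v`, for EVERY frame `(T, a)`, EVERY Borel Haar measure `μZ′` and EVERY Keys
labelling `(π², πⁿ)` with `πⁿ` not square-integrable, `(Ξ ξ₁ v).πs = some c → c = ((hQS ξ₁).1 v hns T a ha h μZ′ π2 πn hK hn).πs`.  Proof: the record at `v` is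
`⟨πⁿ ∘ e₀, some (hSC …).1⟩` (★ `xiPacketFamilyOfRecordSCD_of_nonsplit`), `(hSC …).1` is the `hQS`-witness at the record's binders (`hSCQ`), and the witness is intrinsic
(§2, after identifying the two Borel σ-algebras). [cite: Rogawski1990, §13.1 Prop. 13.1.3 (d), Prop. 13.1.4 p. 199; §12.2 (2) pp. 173–174; §14.6 Thm. 14.6.4 p. 244] -/
theorem signedMembers_recordSCD
    (hμω : ∀ x : Literature.NumberTheory.GaloisRepresentations.ideleGroup ↥(maximalRealSubfield L),
      μω (AdeleRing.ideleBaseChange (↥(maximalRealSubfield L)) L x) = quadraticHeckeCharCM L x)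
    -- THE LINK: the partner of record IS the `hQS`-witness at the record's own binders (`rfl` when `hSC` is built from `hQS`)
    (hSCQ : ∀ (ξ : OneDimAutRepH L) (v : HeightOneSpectrum (𝓞 ↥(maximalRealSubfield L)))
      (hns : ∀ w : PlacesOver L v, IsCMField.complexConj L • w.1 = w.1)
      (T : GL (Fin 3) (LocalRing L v)) (a : LocalRing L v) (ha : IsUnit a)
      (h : formCongr (conjLocal L (IsCMField.complexConj L) v) T (H.map (algebraMap L (LocalRing L v))) =
        a • (Matrix.of fun i j : Fin 3 => if i.val + j.val + 1 = 3 then (1 : L) else 0).map (algebraMap L (LocalRing L v)))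
      (π2 πn : IrrClass (Gqs L v))
      (hK : KeysCaseTwoLabels L v (μω.semilocalComponent L v) (torusLocalComponent L (IsCMField.complexConj L) v ξ.η)
        (torusLocalComponent L (IsCMField.complexConj L) v ξ.ψ) π2 πn) (hn : ¬ πn.IsSquareIntegrable (μZ v)),
      (hSC ξ v hns T a ha h π2 πn hK hn).1 = ((hQS ξ).1 v hns T a ha h (μZ v) π2 πn hK hn).πs)
    (ξ₁ : OneDimAutRepH L) :
    ∀ (v : HeightOneSpectrum (𝓞 ↥(maximalRealSubfield L))) (hns : ∀ w : PlacesOver L v, IsCMField.complexConj L • w.1 = w.1)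
      (T : GL (Fin 3) (LocalRing L v)) (a : LocalRing L v) (ha : IsUnit a)
      (h : formCongr (conjLocal L (IsCMField.complexConj L) v) T (H.map (algebraMap L (LocalRing L v))) =
        a • (Matrix.of fun i j : Fin 3 => if i.val + j.val + 1 = 3 then (1 : L) else 0).map (algebraMap L (LocalRing L v))),
      ∀ [MeasurableSpace (Gqs L v ⧸ Subgroup.center (Gqs L v))] [BorelSpace (Gqs L v ⧸ Subgroup.center (Gqs L v))]
        (μZ' : Measure (Gqs L v ⧸ Subgroup.center (Gqs L v))) [μZ'.IsHaarMeasure],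
      ∀ (π2 πn : IrrClass (Gqs L v))
        (hK : KeysCaseTwoLabels L v (μω.semilocalComponent L v) (torusLocalComponent L (IsCMField.complexConj L) v ξ₁.η)
          (torusLocalComponent L (IsCMField.complexConj L) v ξ₁.ψ) π2 πn)
        (hn : ¬ πn.IsSquareIntegrable μZ') (c : IrrClass ((cmDatum L 3 H).Local v)),
        (xiPacketFamilyOfRecordSCD L H hH hHd μω hμu μZ keys hSC ξ₁ v).πs = some c → c = ((hQS ξ₁).1 v hns T a ha h μZ' π2 πn hK hn).πs := by
  intro v hns T a ha h instM instB μZ' _ π2 πn hK hn c hc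
  -- the two Borel σ-algebras on `U(Φ₃)(L⁺_v)⧸Z` coincide
  have hI : instM = iZ v := by rw [@BorelSpace.measurable_eq _ _ instM instB, @BorelSpace.measurable_eq _ _ (iZ v) (iB v)]
  subst hI
  -- the record at the non-split `v`
  obtain ⟨T₀, a₀, ha₀, h₀, hΞ, -⟩ := xiPacketFamilyOfRecordSCD_of_nonsplit L H hH hHd μω hμu μZ keys hSC ξ₁ v hns
  rw [hΞ] at hc
  cases hc
  rw [hSCQ]
  exact packagePis_eq_of_labels L H hH hHd μω hQS ξ₁ hμω hns T₀ T a₀ a ha₀ ha h₀ h (μZ v) μZ' (keys ξ₁ v hns).1.1 (keys ξ₁ v hns).1.2 π2 πn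
    (keys ξ₁ v hns).2.1 hK (keys ξ₁ v hns).2.2.2 hn

open scoped Classical in
set_option synthInstance.maxHeartbeats 400000 in
set_option maxHeartbeats 8000000 in
/-- **`sgReadBack_of_recordSCD` — THE `hread` PIN OF ★ `definiteAeRigidity_of_parts` AT THE RECORD.**  If the finite constituents of the discrete `P` lie in the A-packet
family of record `Ξ ξ₁ = xiPacketFamilyOfRecordSCD … ξ₁` (at R90-IF-p01's datum: `Γ.mem′ [P] (Γ.PiXi′ ξ₁ …)`, ★ `memPrime_piXiPrime_iff`), then there are `ξ₁′` and a
ξ₁′-local family `F` (★ `IsXiLocalFamily`) containing them whose second members are the SIGNED witnesses — namely `ξ₁′ := ξ₁`, `F := Ξ ξ₁` (★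
`isXiLocalFamily_xiPacketFamilyOfRecordSCD` + `signedMembers_recordSCD`).  Conclusion = ★ p862161's `hread` conclusion, token for token.
[cite: Rogawski1990, §14.6 Thm. 14.6.4 p. 244; §13.1 Prop. 13.1.3 (d), Prop. 13.1.4 p. 199; §12.2 (2) pp. 173–174] -/
theorem sgReadBack_of_recordSCD
    (hμω : ∀ x : Literature.NumberTheory.GaloisRepresentations.ideleGroup ↥(maximalRealSubfield L),
      μω (AdeleRing.ideleBaseChange (↥(maximalRealSubfield L)) L x) = quadraticHeckeCharCM L x)
    -- THE LINK: the partner of record IS the `hQS`-witness at the record's own binders (`rfl` when `hSC` is built from `hQS`)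
    (hSCQ : ∀ (ξ : OneDimAutRepH L) (v : HeightOneSpectrum (𝓞 ↥(maximalRealSubfield L)))
      (hns : ∀ w : PlacesOver L v, IsCMField.complexConj L • w.1 = w.1)
      (T : GL (Fin 3) (LocalRing L v)) (a : LocalRing L v) (ha : IsUnit a)
      (h : formCongr (conjLocal L (IsCMField.complexConj L) v) T (H.map (algebraMap L (LocalRing L v))) =
        a • (Matrix.of fun i j : Fin 3 => if i.val + j.val + 1 = 3 then (1 : L) else 0).map (algebraMap L (LocalRing L v)))
      (π2 πn : IrrClass (Gqs L v))
      (hK : KeysCaseTwoLabels L v (μω.semilocalComponent L v) (torusLocalComponent L (IsCMField.complexConj L) v ξ.η)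
        (torusLocalComponent L (IsCMField.complexConj L) v ξ.ψ) π2 πn) (hn : ¬ πn.IsSquareIntegrable (μZ v)),
      (hSC ξ v hns T a ha h π2 πn hK hn).1 = ((hQS ξ).1 v hns T a ha h (μZ v) π2 πn hK hn).πs)
    {μA : Measure (adelicGroupData (↥(maximalRealSubfield L)) L (IsCMField.complexConj L) 3 H).automorphicQuotient}
    [(adelicGroupData (↥(maximalRealSubfield L)) L (IsCMField.complexConj L) 3 H).IsAutomorphicMeasure μA]
    (P : DiscreteAutomorphicRep (adelicGroupData (↥(maximalRealSubfield L)) L (IsCMField.complexConj L) 3 H) μA)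
    (ξ₁ : OneDimAutRepH L) (hP : LocalConstituentsIn P (xiPacketFamilyOfRecordSCD L H hH hHd μω hμu μZ keys hSC ξ₁)) :
    ∃ (ξ₁' : OneDimAutRepH L) (F : ∀ v : HeightOneSpectrum (𝓞 ↥(maximalRealSubfield L)), CMLocalAPacket L H v),
      ξ₁'.IsXiLocalFamily hH hHd μω hμu F ∧ LocalConstituentsIn P F ∧
      ∀ (v : HeightOneSpectrum (𝓞 ↥(maximalRealSubfield L))) (hns : ∀ w : PlacesOver L v, IsCMField.complexConj L • w.1 = w.1)
        (T : GL (Fin 3) (LocalRing L v)) (a : LocalRing L v) (ha : IsUnit a)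
        (h : formCongr (conjLocal L (IsCMField.complexConj L) v) T (H.map (algebraMap L (LocalRing L v))) =
          a • (Matrix.of fun i j : Fin 3 => if i.val + j.val + 1 = 3 then (1 : L) else 0).map (algebraMap L (LocalRing L v))),
        ∀ [MeasurableSpace (Gqs L v ⧸ Subgroup.center (Gqs L v))] [BorelSpace (Gqs L v ⧸ Subgroup.center (Gqs L v))]
          (μZ : Measure (Gqs L v ⧸ Subgroup.center (Gqs L v))) [μZ.IsHaarMeasure],
        ∀ (π2 πn : IrrClass (Gqs L v))
          (hK : KeysCaseTwoLabels L v (μω.semilocalComponent L v) (torusLocalComponent L (IsCMField.complexConj L) v ξ₁'.η)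
            (torusLocalComponent L (IsCMField.complexConj L) v ξ₁'.ψ) π2 πn)
          (hn : ¬ πn.IsSquareIntegrable μZ) (c : IrrClass ((cmDatum L 3 H).Local v)),
          (F v).πs = some c → c = ((hQS ξ₁').1 v hns T a ha h μZ π2 πn hK hn).πs :=
  ⟨ξ₁, xiPacketFamilyOfRecordSCD L H hH hHd μω hμu μZ keys hSC ξ₁, isXiLocalFamily_xiPacketFamilyOfRecordSCD L H hH hHd μω hμu μZ keys hSC ξ₁, hP,
    signedMembers_recordSCD L H hH hHd Δ mH mG νG νH μω hμu hQS μZ keys hSC hμω hSCQ ξ₁⟩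

open scoped Classical in
set_option synthInstance.maxHeartbeats 400000 in
set_option maxHeartbeats 8000000 in
/-- **`sgTail_of_ae_of_recordSCD` — THE ENGINE'S `hback` AT THE RECORD.**  Under the (S-G) frame of ★ `definiteAeRigidityAt_of_parts` (anisotropic `H`, `μ|𝕀_{L⁺} = ω`,
the signed Q-package `hQS`), for the A-packet family of record `Ξ := xiPacketFamilyOfRecordSCD … μZ keys hSC` linked to `hQS` by `hSCQ`: (AE) for `ξ` and «the finite
constituents of `P` lie in `Ξ ξ₁`» (the datum's `Γ.mem′ [P] (Γ.PiXi′ ξ₁ …)`, ★ `memPrime_piXiPrime_iff`) imply the (S-G) tail of `hRig` for `ξ`, BYTE FOR BYTE — ★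
`sgTail_of_ae_of_xiLocalFamily` fed with `sgReadBack_of_recordSCD`'s parts (Thm. 14.6.4's unique `ξ`: `ξ = ξ₁` from the split places; then `Π′(ξ_v) = {πⁿ, πˢ}(ξ_v) ∘ e`).
So at the datum `hback := fun ξ′ h₁ hS _ hmem => sgTail_of_ae_of_recordSCD … hAE (readH ξ′) (‹mem′ read-back› hmem)`.
[cite: Rogawski1990, §14.6 Thm. 14.6.4 p. 244; §13.1 Prop. 13.1.3 (d), Prop. 13.1.4 p. 199; §12.2 (2) pp. 173–174; §13.3 p. 201] [cite: FlathCorvallis1979, Thm. 3] -/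
theorem sgTail_of_ae_of_recordSCD
    (hanis : ∀ x : Fin 3 → L, Literature.AlgebraicGeometry.ShimuraVarieties.hermForm (cmConjRingHom L) H x x = 0 → x = 0)
    [∀ v : HeightOneSpectrum (𝓞 ↥(maximalRealSubfield L)), BorelSpace ((cmDatum L 3 H).Local v)]
    [∀ v : HeightOneSpectrum (𝓞 ↥(maximalRealSubfield L)),
      BorelSpace ((cmDatum L 2 (Matrix.of fun i j : Fin 2 => if i.val + j.val + 1 = 2 then (1 : L) else 0)).Local v ×
        (cmDatum L 1 (Matrix.of fun i j : Fin 1 => if i.val + j.val + 1 = 1 then (1 : L) else 0)).Local v)]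
    [∀ (v : HeightOneSpectrum (𝓞 ↥(maximalRealSubfield L)))
        (a : ((cmDatum L 2 (Matrix.of fun i j : Fin 2 => if i.val + j.val + 1 = 2 then (1 : L) else 0)).Local v ×
          (cmDatum L 1 (Matrix.of fun i j : Fin 1 => if i.val + j.val + 1 = 1 then (1 : L) else 0)).Local v)),
      BorelSpace (((cmDatum L 2 (Matrix.of fun i j : Fin 2 => if i.val + j.val + 1 = 2 then (1 : L) else 0)).Local v ×
          (cmDatum L 1 (Matrix.of fun i j : Fin 1 => if i.val + j.val + 1 = 1 then (1 : L) else 0)).Local v) ⧸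
        Subgroup.centralizer ({a} : Set ((cmDatum L 2 (Matrix.of fun i j : Fin 2 => if i.val + j.val + 1 = 2 then (1 : L) else 0)).Local v ×
          (cmDatum L 1 (Matrix.of fun i j : Fin 1 => if i.val + j.val + 1 = 1 then (1 : L) else 0)).Local v)))]
    [∀ (v : HeightOneSpectrum (𝓞 ↥(maximalRealSubfield L))) (γ : (cmDatum L 3 H).Local v),
      BorelSpace ((cmDatum L 3 H).Local v ⧸ Subgroup.centralizer ({γ} : Set ((cmDatum L 3 H).Local v)))]
    [∀ v, (νG v).IsHaarMeasure] [∀ v, (νG v).IsMulRightInvariant] [∀ v, (νH v).IsHaarMeasure] [∀ v, (νH v).IsMulRightInvariant]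
    (hμω : ∀ x : Literature.NumberTheory.GaloisRepresentations.ideleGroup ↥(maximalRealSubfield L),
      μω (AdeleRing.ideleBaseChange (↥(maximalRealSubfield L)) L x) = quadraticHeckeCharCM L x)
    -- THE LINK: the partner of record IS the `hQS`-witness at the record's own binders (`rfl` when `hSC` is built from `hQS`)
    (hSCQ : ∀ (ξ : OneDimAutRepH L) (v : HeightOneSpectrum (𝓞 ↥(maximalRealSubfield L)))
      (hns : ∀ w : PlacesOver L v, IsCMField.complexConj L • w.1 = w.1)
      (T : GL (Fin 3) (LocalRing L v)) (a : LocalRing L v) (ha : IsUnit a)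
      (h : formCongr (conjLocal L (IsCMField.complexConj L) v) T (H.map (algebraMap L (LocalRing L v))) =
        a • (Matrix.of fun i j : Fin 3 => if i.val + j.val + 1 = 3 then (1 : L) else 0).map (algebraMap L (LocalRing L v)))
      (π2 πn : IrrClass (Gqs L v))
      (hK : KeysCaseTwoLabels L v (μω.semilocalComponent L v) (torusLocalComponent L (IsCMField.complexConj L) v ξ.η)
        (torusLocalComponent L (IsCMField.complexConj L) v ξ.ψ) π2 πn) (hn : ¬ πn.IsSquareIntegrable (μZ v)),
      (hSC ξ v hns T a ha h π2 πn hK hn).1 = ((hQS ξ).1 v hns T a ha h (μZ v) π2 πn hK hn).πs)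
    (ξ : OneDimAutRepH L)
    (μA : Measure (adelicGroupData (↥(maximalRealSubfield L)) L (IsCMField.complexConj L) 3 H).automorphicQuotient)
    [(adelicGroupData (↥(maximalRealSubfield L)) L (IsCMField.complexConj L) 3 H).IsAutomorphicMeasure μA]
    (P : DiscreteAutomorphicRep (adelicGroupData (↥(maximalRealSubfield L)) L (IsCMField.complexConj L) 3 H) μA)
    (hAE :
      (∃ S : Finset (HeightOneSpectrum (𝓞 ↥(maximalRealSubfield L))),
        (∀ v : HeightOneSpectrum (𝓞 ↥(maximalRealSubfield L)), v ∉ S →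
          ∀ (hns : ∀ w : PlacesOver L v, IsCMField.complexConj L • w.1 = w.1)
            (T : GL (Fin 3) (LocalRing L v)) (a : LocalRing L v) (ha : IsUnit a)
            (h : formCongr (conjLocal L (IsCMField.complexConj L) v) T (H.map (algebraMap L (LocalRing L v))) =
              a • (Matrix.of fun i j : Fin 3 => if i.val + j.val + 1 = 3 then (1 : L) else 0).map (algebraMap L (LocalRing L v))),
          ∀ [MeasurableSpace (Gqs L v ⧸ Subgroup.center (Gqs L v))] [BorelSpace (Gqs L v ⧸ Subgroup.center (Gqs L v))]
            (μZ : Measure (Gqs L v ⧸ Subgroup.center (Gqs L v))) [μZ.IsHaarMeasure],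
          ∀ (π2 πn : IrrClass (Gqs L v)),
            KeysCaseTwoLabels L v (μω.semilocalComponent L v) (torusLocalComponent L (IsCMField.complexConj L) v ξ.η)
              (torusLocalComponent L (IsCMField.complexConj L) v ξ.ψ) π2 πn →
            ¬ πn.IsSquareIntegrable μZ →
            ∀ c : IrrClass ((cmDatum L 3 H).Local v),
              (IrrClass.comap (localPiEquiv L (IsCMField.complexConj L) 3 H v) c).IsConstituentOf
                  (P.finRep.smoothPart.toRepresentation.comp (inclPlace (↥(maximalRealSubfield L)) L (IsCMField.complexConj L) 3 H v)) →
              c = IrrClass.comap (cmDatumLocalCongr L v T ha h).symm πn) ∧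
        (∀ v : HeightOneSpectrum (𝓞 ↥(maximalRealSubfield L)), v ∉ S →
          ∀ (hs : ∃ w : PlacesOver L v, IsCMField.complexConj L • w.1 ≠ w.1),
            ∀ c : IrrClass ((cmDatum L 3 H).Local v),
              (IrrClass.comap (localPiEquiv L (IsCMField.complexConj L) 3 H v) c).IsConstituentOf
                  (P.finRep.smoothPart.toRepresentation.comp (inclPlace (↥(maximalRealSubfield L)) L (IsCMField.complexConj L) 3 H v)) →
              c ∈ (cmSplitPacket L H hH hHd v (splitWitness v hs) (splitWitness_spec v hs) (ξ.splitν₀ μω (splitWitness v hs).1)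
                (ξ.locψ (splitWitness v hs).1) (ξ.norm_splitν₀_apply hμu (splitWitness v hs).1)
                (ξ.continuous_splitν₀ μω (splitWitness v hs).1) (ξ.norm_locψ_apply (splitWitness v hs).1)
                (ξ.continuous_locψ (splitWitness v hs).1)).members)))
    (ξ₁ : OneDimAutRepH L) (hP : LocalConstituentsIn P (xiPacketFamilyOfRecordSCD L H hH hHd μω hμu μZ keys hSC ξ₁)) :
    ∀ (v : HeightOneSpectrum (𝓞 ↥(maximalRealSubfield L))) (hns : ∀ w : PlacesOver L v, IsCMField.complexConj L • w.1 = w.1),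
    ∀ (T : GL (Fin 3) (LocalRing L v)) (a : LocalRing L v) (ha : IsUnit a)
      (h : formCongr (conjLocal L (IsCMField.complexConj L) v) T (H.map (algebraMap L (LocalRing L v))) =
        a • (Matrix.of fun i j : Fin 3 => if i.val + j.val + 1 = 3 then (1 : L) else 0).map (algebraMap L (LocalRing L v))),
    ∀ [MeasurableSpace (Gqs L v ⧸ Subgroup.center (Gqs L v))] [BorelSpace (Gqs L v ⧸ Subgroup.center (Gqs L v))]
      (μZ : Measure (Gqs L v ⧸ Subgroup.center (Gqs L v))) [μZ.IsHaarMeasure],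
    ∀ (π2 πn : IrrClass (Gqs L v)),
    ∀ (hK : KeysCaseTwoLabels L v (μω.semilocalComponent L v) (torusLocalComponent L (IsCMField.complexConj L) v ξ.η)
        (torusLocalComponent L (IsCMField.complexConj L) v ξ.ψ) π2 πn)
      (hn : ¬ πn.IsSquareIntegrable μZ),
      -- (S-G) «13.3.6 (c) ∕ §14.6 AT PRINT'S PINNED DATA»: every v-constituent of P is πⁿ ∘ e, π² ∘ e, or the πˢ(ξ_v) ∘ e of `hQS`
      ∀ c : IrrClass ((cmDatum L 3 H).Local v),
        (IrrClass.comap (localPiEquiv L (IsCMField.complexConj L) 3 H v) c).IsConstituentOf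
            (P.finRep.smoothPart.toRepresentation.comp (inclPlace (↥(maximalRealSubfield L)) L (IsCMField.complexConj L) 3 H v)) →
        c = IrrClass.comap (cmDatumLocalCongr L v T ha h).symm πn ∨
          c = IrrClass.comap (cmDatumLocalCongr L v T ha h).symm π2 ∨
          c = ((hQS ξ).1 v hns T a ha h μZ π2 πn hK hn).πs := by
  obtain ⟨ξ₁', F, hF, hFP, hFs⟩ := sgReadBack_of_recordSCD L H hH hHd Δ mH mG νG νH μω hμu hQS μZ keys hSC hμω hSCQ P ξ₁ hP
  exact sgTail_of_ae_of_xiLocalFamily L H hH hHd hanis Δ mH mG νG νH μω hμu hμω hQS ξ μA P hAE ξ₁' F hF hFP hFs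

end Record

end Summit.HodgeConjecture.HodgeConjecture.R90.S9

end
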